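import Mathlib
import Summits.ValiantsHypothesis.ValiantsHypothesis.Theorems.LiouvilleSarnakBilinearImpliesCutRank
import HarnessLib

/-!
# Route LiouvilleSarnak — the Hankel rung R1, unconditional core (item stmt-ValiantsHypothesis-14780)

`HankelSpectralRank`: for every `n` and `B > 0`, if the Liouville exponential sum of length
`2^{n+1}` is uniformly bounded, `sup_θ |Σ_{k<2^{n+1}} λ(k) e(kθ)| ≤ B`, then the `2^n × 2^n` Hankel
matrix `H = (λ(a+b+1))_{a,b<2^n}` satisfies `4^n ≤ B² · rank H`.

Proof (finite Fourier analysis; no measure theory). Put `M = 2^{n+1}`, `ζ = e(1/M)` (a primitive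
`M`-th root of unity, `Complex.isPrimitiveRoot_exp`) and `S_j = Σ_{k<M} λ(k) ζ^{kj} = S(j/M)`, so
`|S_j| ≤ B`. Fourier inversion on `ℤ/M` gives `λ(m) = M⁻¹ Σ_{j<M} S_j conj(ζ^{mj})` for `m < M`
(`fourier_inversion`), whence for `u, w : Fin 2^n → ℂ`
`Σ_{a,b} u_a w_b λ(a+b+1) = M⁻¹ Σ_j S_j conj(ζ^j) U_j W_j` with `U_j = Σ_a u_a conj(ζ^{aj})`,
`W_j = Σ_b w_b conj(ζ^{bj})` (`bilinear_eq`); the discrete Parseval identity `Σ_j |U_j|² = M ‖u‖²`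
(`parseval`) and Cauchy–Schwarz give `|uᵀ H w|² ≤ B² ‖u‖² ‖w‖²` (`bilinear_bound`). Since
`|λ(m)| = 1` for `m ≥ 1`, the tree's `one_le_mul_rank_of_bilinear_bound`
(`LiouvilleSarnakBilinearImpliesCutRank.lean`: `rank ≥ ‖H‖_F² / ‖H‖_op²` via the spectral theorem)
with `ε = B²/4^n` yields `4^n ≤ B² rank H`.

* `hankelSpectralRank_proof : HankelSpectralRank` — the item, verbatim.

Honest framing: an unconditional linear-algebra lemma filed as route bookkeeping; the route's
number-theoretic inputs (Davenport / GRH bounds on `B`) are not touched, and nothing here is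
progress on VP ≠ VNP.

## References

* H. L. Montgomery, R. C. Vaughan, *Multiplicative Number Theory I*, CUP 2007, §1 (finite Fourier
  analysis on `ℤ/M`: inversion and Parseval for roots of unity). [cite: MontgomeryVaughan2007, §1]
* N. Nisan, *Lower bounds for non-commutative computation*, STOC 1991 (rank of partial-derivative /
  Hankel-type matrices as the lower-bound measure). [cite: Nisan1991Noncommutative, §2]
-/

set_option linter.dupNamespace false

noncomputable section

open Finset Complex

namespace Summit.ValiantsHypothesis.ValiantsHypothesis.Theorems.LiouvilleSarnakHankel

open scoped ComplexConjugate

/-! ### §1 Roots of unity: orthogonality, inversion, Parseval -/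

/-- Geometric sum of an `M`-th root of unity: `Σ_{j<M} ω^j = M` if `ω = 1` and `0` otherwise.
[folklore] -/
theorem geom_sum_root_of_unity {M : ℕ} {ω : ℂ} (hω : ω ^ M = 1) :
    ∑ j ∈ range M, ω ^ j = if ω = 1 then (M : ℂ) else 0 := by
  split_ifs with h
  · simp [h]
  · rw [geom_sum_eq h, hω, sub_self, zero_div]

/-- For a primitive `M`-th root of unity `ζ` and `a, a' < M`:
`Σ_{j<M} conj(ζ^{a j}) ζ^{a' j} = M` if `a = a'` and `0` otherwise. [folklore] -/
theorem sum_conj_pow_mul_pow {M : ℕ} {ζ : ℂ} (hζ : IsPrimitiveRoot ζ M) (hM : 0 < M) {a a' : ℕ}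
    (ha : a < M) (ha' : a' < M) :
    ∑ j ∈ range M, conj (ζ ^ (a * j)) * ζ ^ (a' * j) = if a = a' then (M : ℂ) else 0 := by
  have hnorm : ‖ζ‖ = 1 := hζ.norm'_eq_one hM.ne'
  have hζa : ‖ζ ^ a‖ = 1 := by rw [norm_pow, hnorm, one_pow]
  have hne : ζ ^ a ≠ 0 := fun h => by simp [h] at hζa
  -- `conj (ζ^a) = (ζ^a)⁻¹`
  have hconj : conj (ζ ^ a) = (ζ ^ a)⁻¹ := by
    rw [Complex.inv_def, Complex.normSq_eq_norm_sq, hζa]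
    simp
  set ω := conj (ζ ^ a) * ζ ^ a' with hω
  have hterm : ∀ j, conj (ζ ^ (a * j)) * ζ ^ (a' * j) = ω ^ j := by
    intro j
    rw [hω, mul_pow, pow_mul, pow_mul, map_pow]
  simp_rw [hterm]
  have hωM : ω ^ M = 1 := by
    rw [hω, mul_pow, ← map_pow, ← pow_mul, ← pow_mul, mul_comm a M, mul_comm a' M, pow_mul,
      pow_mul, hζ.pow_eq_one, one_pow, one_pow, map_one, one_mul]
  rw [geom_sum_root_of_unity hωM]
  have hiff : ω = 1 ↔ a = a' := by
    rw [hω, hconj, inv_mul_eq_one₀ hne]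
    constructor
    · intro h
      exact hζ.pow_inj ha ha' h
    · rintro rfl
      rfl
  by_cases h : a = a'
  · rw [if_pos h, if_pos (hiff.2 h)]
  · rw [if_neg h, if_neg (mt hiff.1 h)]

/-- **Fourier inversion on `ℤ/M`**: for `m < M`,
`Σ_{j<M} (Σ_{k<M} c_k ζ^{kj}) conj(ζ^{mj}) = M c_m`. [folklore] -/
theorem fourier_inversion {M : ℕ} {ζ : ℂ} (hζ : IsPrimitiveRoot ζ M) (hM : 0 < M) (c : ℕ → ℂ)
    {m : ℕ} (hm : m < M) :
    ∑ j ∈ range M, (∑ k ∈ range M, c k * ζ ^ (k * j)) * conj (ζ ^ (m * j)) = (M : ℂ) * c m := by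
  calc ∑ j ∈ range M, (∑ k ∈ range M, c k * ζ ^ (k * j)) * conj (ζ ^ (m * j))
      = ∑ j ∈ range M, ∑ k ∈ range M, c k * ζ ^ (k * j) * conj (ζ ^ (m * j)) := by
        simp_rw [sum_mul]
    _ = ∑ k ∈ range M, ∑ j ∈ range M, c k * ζ ^ (k * j) * conj (ζ ^ (m * j)) := sum_comm
    _ = ∑ k ∈ range M, c k * ∑ j ∈ range M, conj (ζ ^ (m * j)) * ζ ^ (k * j) := by
        refine sum_congr rfl fun k _ => ?_
        rw [mul_sum]
        exact sum_congr rfl fun j _ => by ring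
    _ = ∑ k ∈ range M, c k * (if m = k then (M : ℂ) else 0) := by
        refine sum_congr rfl fun k hk => ?_
        rw [sum_conj_pow_mul_pow hζ hM hm (mem_range.1 hk)]
    _ = (M : ℂ) * c m := by
        rw [sum_eq_single m (fun k _ hk => by rw [if_neg (Ne.symm hk), mul_zero])
          (fun h => absurd (mem_range.2 hm) h), if_pos rfl, mul_comm]

/-- **Discrete Parseval**: for `N ≤ M` and `u : Fin N → ℂ`,
`Σ_{j<M} ‖Σ_a u_a conj(ζ^{aj})‖² = M · Σ_a ‖u_a‖²`. [folklore] -/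
theorem parseval {M N : ℕ} {ζ : ℂ} (hζ : IsPrimitiveRoot ζ M) (hM : 0 < M) (hNM : N ≤ M)
    (u : Fin N → ℂ) :
    ∑ j ∈ range M, ‖∑ a : Fin N, u a * conj (ζ ^ ((a : ℕ) * j))‖ ^ 2 =
      (M : ℝ) * ∑ a : Fin N, ‖u a‖ ^ 2 := by
  -- work in `ℂ`
  apply Complex.ofReal_injective
  rw [Complex.ofReal_sum, Complex.ofReal_mul, Complex.ofReal_natCast, Complex.ofReal_sum]
  have hsq : ∀ z : ℂ, ((‖z‖ ^ 2 : ℝ) : ℂ) = z * conj z := fun z => by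
    rw [Complex.mul_conj, Complex.normSq_eq_norm_sq]
  calc ∑ j ∈ range M, ((‖∑ a : Fin N, u a * conj (ζ ^ ((a : ℕ) * j))‖ ^ 2 : ℝ) : ℂ)
      = ∑ j ∈ range M, (∑ a : Fin N, u a * conj (ζ ^ ((a : ℕ) * j))) *
          conj (∑ a : Fin N, u a * conj (ζ ^ ((a : ℕ) * j))) := sum_congr rfl fun j _ => hsq _
    _ = ∑ j ∈ range M, ∑ a : Fin N, ∑ a' : Fin N,
          u a * conj (u a') * (conj (ζ ^ ((a : ℕ) * j)) * ζ ^ ((a' : ℕ) * j)) := by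
        refine sum_congr rfl fun j _ => ?_
        rw [map_sum, sum_mul_sum]
        refine sum_congr rfl fun a _ => sum_congr rfl fun a' _ => ?_
        rw [map_mul, Complex.conj_conj]
        ring
    _ = ∑ a : Fin N, ∑ a' : Fin N, u a * conj (u a') *
          ∑ j ∈ range M, conj (ζ ^ ((a : ℕ) * j)) * ζ ^ ((a' : ℕ) * j) := by
        rw [sum_comm]
        refine sum_congr rfl fun a _ => ?_
        rw [sum_comm]
        refine sum_congr rfl fun a' _ => ?_
        rw [mul_sum]
    _ = ∑ a : Fin N, ∑ a' : Fin N, u a * conj (u a') * (if (a : ℕ) = a' then (M : ℂ) else 0) := by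
        refine sum_congr rfl fun a _ => sum_congr rfl fun a' _ => ?_
        rw [sum_conj_pow_mul_pow hζ hM (lt_of_lt_of_le a.isLt hNM) (lt_of_lt_of_le a'.isLt hNM)]
    _ = ∑ a : Fin N, u a * conj (u a) * (M : ℂ) := by
        refine sum_congr rfl fun a _ => ?_
        simp_rw [Fin.val_inj]
        rw [Fintype.sum_eq_single a (fun a' ha' => by rw [if_neg (Ne.symm ha'), mul_zero])]
        rw [if_pos rfl]
    _ = (M : ℂ) * ∑ a : Fin N, ((‖u a‖ ^ 2 : ℝ) : ℂ) := by
        rw [mul_sum]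
        exact sum_congr rfl fun a _ => by rw [hsq]; ring

/-! ### §2 The bilinear bound -/

/-- **The bilinear form of the Hankel matrix through the Fourier side**: with
`S_j = Σ_{k<M} c_k ζ^{kj}`, `U_j = Σ_a u_a conj(ζ^{aj})`, `W_j = Σ_b w_b conj(ζ^{bj})` and
`2N ≤ M`, `Σ_{a,b<N} u_a w_b c_{a+b+1} = M⁻¹ Σ_{j<M} S_j conj(ζ^j) U_j W_j`. [folklore] -/
theorem bilinear_eq {M N : ℕ} {ζ : ℂ} (hζ : IsPrimitiveRoot ζ M) (hM : 0 < M) (hNM : 2 * N ≤ M)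
    (c : ℕ → ℂ) (u w : Fin N → ℂ) :
    ∑ a : Fin N, ∑ b : Fin N, u a * w b * c ((a : ℕ) + b + 1) =
      (M : ℂ)⁻¹ * ∑ j ∈ range M, (∑ k ∈ range M, c k * ζ ^ (k * j)) * conj (ζ ^ j) *
        (∑ a : Fin N, u a * conj (ζ ^ ((a : ℕ) * j))) *
        (∑ b : Fin N, w b * conj (ζ ^ ((b : ℕ) * j))) := by
  have hMne : (M : ℂ) ≠ 0 := by exact_mod_cast hM.ne'
  -- Fourier inversion for each `m = a + b + 1 < M`
  have hinv : ∀ a b : Fin N, c ((a : ℕ) + b + 1) = (M : ℂ)⁻¹ *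
      ∑ j ∈ range M, (∑ k ∈ range M, c k * ζ ^ (k * j)) * conj (ζ ^ (((a : ℕ) + b + 1) * j)) := by
    intro a b
    have hm : (a : ℕ) + b + 1 < M := by have := a.isLt; have := b.isLt; omega
    rw [fourier_inversion hζ hM c hm, ← mul_assoc, inv_mul_cancel₀ hMne, one_mul]
  simp_rw [hinv]
  set S : ℕ → ℂ := fun j => ∑ k ∈ range M, c k * ζ ^ (k * j) with hSdef
  have hpow : ∀ (a b : Fin N) (j : ℕ), conj (ζ ^ (((a : ℕ) + b + 1) * j)) =
      conj (ζ ^ j) * conj (ζ ^ ((a : ℕ) * j)) * conj (ζ ^ ((b : ℕ) * j)) := by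
    intro a b j
    rw [← map_mul, ← map_mul, ← pow_add, ← pow_add]
    congr 2
    ring
  symm
  calc (M : ℂ)⁻¹ * ∑ j ∈ range M, S j * conj (ζ ^ j) *
          (∑ a : Fin N, u a * conj (ζ ^ ((a : ℕ) * j))) *
          (∑ b : Fin N, w b * conj (ζ ^ ((b : ℕ) * j)))
      = (M : ℂ)⁻¹ * ∑ j ∈ range M, ∑ a : Fin N, ∑ b : Fin N,
          S j * conj (ζ ^ j) * (u a * conj (ζ ^ ((a : ℕ) * j))) *
            (w b * conj (ζ ^ ((b : ℕ) * j))) := by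
        congr 1
        refine sum_congr rfl fun j _ => ?_
        rw [mul_assoc (S j * conj (ζ ^ j)), sum_mul_sum, mul_sum]
        refine sum_congr rfl fun a _ => ?_
        rw [mul_sum]
        refine sum_congr rfl fun b _ => ?_
        ring
    _ = ∑ a : Fin N, ∑ b : Fin N, (M : ℂ)⁻¹ * ∑ j ∈ range M,
          S j * conj (ζ ^ j) * (u a * conj (ζ ^ ((a : ℕ) * j))) *
            (w b * conj (ζ ^ ((b : ℕ) * j))) := by
        rw [sum_comm, mul_sum]
        refine sum_congr rfl fun a _ => ?_
        rw [sum_comm, mul_sum]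
    _ = ∑ a : Fin N, ∑ b : Fin N, u a * w b *
          ((M : ℂ)⁻¹ * ∑ j ∈ range M, S j * conj (ζ ^ (((a : ℕ) + b + 1) * j))) := by
        refine sum_congr rfl fun a _ => sum_congr rfl fun b _ => ?_
        rw [mul_sum, mul_sum, mul_sum]
        refine sum_congr rfl fun j _ => ?_
        rw [hpow]
        ring

/-- **`|uᵀ H w|² ≤ B² ‖u‖² ‖w‖²`** for the Hankel matrix `(c_{a+b+1})_{a,b<N}` when the length-`M`
exponential sums `S_j` (`M ≥ 2N`) are bounded by `B`. [folklore] -/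
theorem bilinear_bound {M N : ℕ} {ζ : ℂ} (hζ : IsPrimitiveRoot ζ M) (hM : 0 < M) (hNM : 2 * N ≤ M)
    (c : ℕ → ℂ) {B : ℝ} (_hB : 0 ≤ B)
    (hS : ∀ j ∈ range M, ‖∑ k ∈ range M, c k * ζ ^ (k * j)‖ ≤ B) (u w : Fin N → ℂ) :
    ‖∑ a : Fin N, ∑ b : Fin N, u a * w b * c ((a : ℕ) + b + 1)‖ ^ 2 ≤
      B ^ 2 * (∑ a, ‖u a‖ ^ 2) * (∑ b, ‖w b‖ ^ 2) := by
  have hN : N ≤ M := by omega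
  set U : ℕ → ℂ := fun j => ∑ a : Fin N, u a * conj (ζ ^ ((a : ℕ) * j)) with hU
  set W : ℕ → ℂ := fun j => ∑ b : Fin N, w b * conj (ζ ^ ((b : ℕ) * j)) with hW
  have hnorm : ‖ζ‖ = 1 := hζ.norm'_eq_one hM.ne'
  have hMpos : (0 : ℝ) < M := by exact_mod_cast hM
  -- Step 1: `‖uᵀ H w‖ ≤ (B/M) Σ_j ‖U_j‖ ‖W_j‖`
  have h1 : ‖∑ a : Fin N, ∑ b : Fin N, u a * w b * c ((a : ℕ) + b + 1)‖ ≤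
      B / M * ∑ j ∈ range M, ‖U j‖ * ‖W j‖ := by
    rw [bilinear_eq hζ hM hNM c u w, norm_mul, norm_inv, Complex.norm_natCast, div_eq_mul_inv,
      mul_comm B, mul_assoc, mul_sum]
    refine mul_le_mul_of_nonneg_left ((norm_sum_le _ _).trans (sum_le_sum fun j hj => ?_))
      (by positivity)
    rw [norm_mul, norm_mul, norm_mul, Complex.norm_conj, norm_pow, hnorm, one_pow, mul_one]
    have := hS j hj
    have hUW : 0 ≤ ‖U j‖ * ‖W j‖ := by positivity
    calc ‖∑ k ∈ range M, c k * ζ ^ (k * j)‖ * ‖U j‖ * ‖W j‖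
        = ‖∑ k ∈ range M, c k * ζ ^ (k * j)‖ * (‖U j‖ * ‖W j‖) := by ring
      _ ≤ B * (‖U j‖ * ‖W j‖) := mul_le_mul_of_nonneg_right this hUW
  -- Step 2: Cauchy–Schwarz and Parseval
  have h2 : (∑ j ∈ range M, ‖U j‖ * ‖W j‖) ^ 2 ≤
      (∑ j ∈ range M, ‖U j‖ ^ 2) * (∑ j ∈ range M, ‖W j‖ ^ 2) :=
    sum_mul_sq_le_sq_mul_sq _ _ _
  have hPU : ∑ j ∈ range M, ‖U j‖ ^ 2 = (M : ℝ) * ∑ a, ‖u a‖ ^ 2 := parseval hζ hM hN u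
  have hPW : ∑ j ∈ range M, ‖W j‖ ^ 2 = (M : ℝ) * ∑ b, ‖w b‖ ^ 2 := parseval hζ hM hN w
  have h0 : 0 ≤ ‖∑ a : Fin N, ∑ b : Fin N, u a * w b * c ((a : ℕ) + b + 1)‖ := norm_nonneg _
  have hsum0 : 0 ≤ ∑ j ∈ range M, ‖U j‖ * ‖W j‖ := sum_nonneg fun j _ => by positivity
  calc ‖∑ a : Fin N, ∑ b : Fin N, u a * w b * c ((a : ℕ) + b + 1)‖ ^ 2
      ≤ (B / M * ∑ j ∈ range M, ‖U j‖ * ‖W j‖) ^ 2 := by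
        exact pow_le_pow_left₀ h0 h1 2
    _ = (B / M) ^ 2 * (∑ j ∈ range M, ‖U j‖ * ‖W j‖) ^ 2 := by ring
    _ ≤ (B / M) ^ 2 * ((∑ j ∈ range M, ‖U j‖ ^ 2) * (∑ j ∈ range M, ‖W j‖ ^ 2)) :=
        mul_le_mul_of_nonneg_left h2 (by positivity)
    _ = B ^ 2 * (∑ a, ‖u a‖ ^ 2) * (∑ b, ‖w b‖ ^ 2) := by
        rw [hPU, hPW]
        field_simp

/-! ### §3 The item -/

/-- `|λ(m)| = 1` for `m ≥ 1` (as a complex number). [folklore] -/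
theorem norm_liouville_eq_one {m : ℕ} (hm : m ≠ 0) :
    ‖(((ArithmeticFunction.liouville m : ℤ)) : ℂ)‖ = 1 := by
  rw [ArithmeticFunction.liouville_apply hm]
  push_cast
  rw [norm_pow, norm_neg, norm_one, one_pow]

/-- **Route LiouvilleSarnak, item `HankelSpectralRank` (stmt-ValiantsHypothesis-14780)**: for every
`n` and `B > 0`, `sup_θ |Σ_{k<2^{n+1}} λ(k) e(kθ)| ≤ B` implies `4^n ≤ B² · rank (λ(a+b+1))_{a,b<2^n}`.
Finite Fourier analysis on the `2^{n+1}`-th roots of unity plus the tree's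
`one_le_mul_rank_of_bilinear_bound`. [cite: MontgomeryVaughan2007, §1]
[cite: Nisan1991Noncommutative, §2] -/
theorem hankelSpectralRank_proof : Theses.LiouvilleSarnak.HankelSpectralRank := by
  intro n B hB hθ
  set N := 2 ^ n with hN
  set M := 2 ^ (n + 1) with hM
  have hMpos : 0 < M := by positivity
  have hNM : 2 * N = M := by rw [hN, hM, pow_succ]; ring
  set ζ : ℂ := Complex.exp (2 * Real.pi * Complex.I / M) with hζdef
  have hζ : IsPrimitiveRoot ζ M := Complex.isPrimitiveRoot_exp M hMpos.ne'
  set c : ℕ → ℂ := fun k => ((ArithmeticFunction.liouville k : ℤ) : ℂ) with hc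
  -- the exponential sums at `θ = j/M` are the `S_j`
  have hS : ∀ j ∈ range M, ‖∑ k ∈ range M, c k * ζ ^ (k * j)‖ ≤ B := by
    intro j _
    have h := hθ ((j : ℝ) / M)
    have heq : ∑ k ∈ range M, ((ArithmeticFunction.liouville k : ℤ) : ℂ) *
        Complex.exp (2 * Real.pi * Complex.I * (((j : ℝ) / M : ℝ) : ℂ) * k) =
        ∑ k ∈ range M, c k * ζ ^ (k * j) := by
      refine sum_congr rfl fun k _ => ?_
      have harg : (2 * Real.pi * Complex.I * (((j : ℝ) / M : ℝ) : ℂ) * k : ℂ) =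
          ((k * j : ℕ) : ℂ) * (2 * Real.pi * Complex.I / M) := by
        have hMne : (M : ℂ) ≠ 0 := by exact_mod_cast hMpos.ne'
        push_cast
        field_simp
        try ring
      rw [hc, hζdef, ← Complex.exp_nat_mul, harg]
    rwa [heq] at h
  -- the bilinear bound in the shape of `one_le_mul_rank_of_bilinear_bound`
  have hcard : Fintype.card (Fin (2 ^ n)) = N := Fintype.card_fin _
  have hNpos : 0 < Fintype.card (Fin (2 ^ n)) := by rw [hcard]; positivity
  have hNreal : (0 : ℝ) < N := by positivity
  have hbil : ∀ u w : Fin (2 ^ n) → ℂ,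
      ‖∑ r, ∑ s, u r * w s * (Matrix.of fun a b : Fin (2 ^ n) =>
          (((ArithmeticFunction.liouville ((a : ℕ) + (b : ℕ) + 1) : ℤ)) : ℂ)) r s‖ ^ 2 ≤
        B ^ 2 / (N : ℝ) ^ 2 * (Fintype.card (Fin (2 ^ n)) : ℝ) ^ 2 *
          (∑ r, ‖u r‖ ^ 2) * (∑ s, ‖w s‖ ^ 2) := by
    intro u w
    rw [hcard, div_mul_cancel₀ _ (by positivity)]
    simp only [Matrix.of_apply]
    exact bilinear_bound hζ hMpos hNM.le c hB.le hS u w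
  have key := LiouvilleSarnak.one_le_mul_rank_of_bilinear_bound hNpos
    (Matrix.of fun a b : Fin (2 ^ n) => (((ArithmeticFunction.liouville ((a : ℕ) + (b : ℕ) + 1) : ℤ)) : ℂ))
    (fun r s => norm_liouville_eq_one (by omega)) (by positivity : 0 < B ^ 2 / (N : ℝ) ^ 2) hbil
  -- `1 ≤ (B²/N²) · rank` ⇒ `N² ≤ B² · rank`
  have h4 : (4 : ℝ) ^ n = (N : ℝ) ^ 2 := by
    rw [hN]; push_cast; rw [sq, ← mul_pow]; norm_num
  rw [h4]
  have hN2 : (0 : ℝ) < (N : ℝ) ^ 2 := by positivity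
  calc (N : ℝ) ^ 2 = (N : ℝ) ^ 2 * 1 := by ring
    _ ≤ (N : ℝ) ^ 2 * (B ^ 2 / (N : ℝ) ^ 2 * ((Matrix.of fun a b : Fin (2 ^ n) =>
          (((ArithmeticFunction.liouville ((a : ℕ) + (b : ℕ) + 1) : ℤ)) : ℂ)).rank : ℝ)) := by
        gcongr
    _ = B ^ 2 * ((Matrix.of fun a b : Fin (2 ^ n) =>
          (((ArithmeticFunction.liouville ((a : ℕ) + (b : ℕ) + 1) : ℤ)) : ℂ)).rank : ℝ) := by
        field_simp

end Summit.ValiantsHypothesis.ValiantsHypothesis.Theorems.LiouvilleSarnakHankel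

end
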